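import Literature.NumberTheory.Automorphic.UnitaryGroupBorelInduction
import Literature.NumberTheory.Rogawski1990.CMLocalAPacketMembers
import Summits.HodgeConjecture.HodgeConjecture.Theorems.F0P2nFrobeniusFunctional
import HarnessLib

/-!
# Stub J2b of line `Cruxes/H413/Lines/F0_P2GR91NJacquet.lean`: every character of the Borel subgroup `B = T N` of
# `U(Φ₃)(R)` kills `N`; hence `δ_B` and `δ_B^{1/2}` are trivial on `N(L⁺_v)` — the hypothesis `hδ` of
# ★ `Representation.frobenius_normalizedInd` for the quasi-split `U(3)` at a finite place

Cell hodgecm-mathlib F0∕P2, crux `stmt-HodgeConjecture-24833` (`H413`); companion of ★ `F0P2nFrobeniusFunctional` (J2).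
PURELY ALGEBRAIC (no measure theory beyond the definition of ★ `deltaChar`∕`rootDeltaChar` as homomorphisms `B →* ℂˣ`):
over any commutative ring `R` in which `2` and `3` are units, for the antidiagonal form `Φ₃` and any ring endomorphism
`σ`, every homomorphism `χ : B → C` to a commutative group is trivial on the upper-unitriangular subgroup `N`.
Proof ([Rogawski1990, §1.10] coordinates): with `t_α = d(α, 1, α⁻¹) ∈ T`, `t_2 u t_2⁻¹ = u² ζ` with `ζ ∈ N`, `ζ₀₁ = 0` (so
`ζ₁₂ = -σ(ζ₀₁) = 0` by unitarity); for such `ζ`, `t_2 ζ t_2⁻¹ = ζ⁴`, `t_3 ζ t_3⁻¹ = ζ⁹`, so `χ ζ ³ = χ ζ ⁸ = 1`, `χ ζ = 1`, and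
`χ u = χ u ² χ ζ` gives `χ u = 1` — the `U(3)` analogue of ★ `map_eq_one_of_mem_unipotentRadicalP` (BZ 1977, 1.8).

* §1 `3 × 3` bookkeeping: the entries of `Φ₃`, the unitarity relation `u₁₂ = -σ(u₀₁)` on `N`, conjugation by a diagonal.
* §2 `map_eq_one_of_mem_unipotentU` (generic `R`, `σ`, `J = Φ₃`; `_of_eq` for a form given equal to `Φ₃`) and
  `map_eq_map_proj_of_eq` (characters of `B` factor through the Levi projection).
* §3 generic parabolic triples: `δ_P^{1/2}|_N = 1 ⇒ δ_P^{1/2}(p) = δ_P^{1/2}(proj p)`, `δ_P|_N = 1`, and the J2 variant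
  `exists_intertwiningMap_normalizedInd_character_of_functional_proj` whose functional is equivariant for
  `χ (proj p) · δ_P^{1/2} (proj p)` (the shape a Jacquet-module ∕ `N`-coinvariant functional delivers).
* §4 the CM Borel ★ `cmBorelTriple L 3 v` (`R = ∏_{w ∣ v} L_w`, where `2, 3` are units): `deltaChar … n = 1` (the `hδ` of
  ★ `Representation.frobenius_normalizedInd` VERBATIM — combine with ★ `frobenius_normalizedInd_holds` of
  `JacquetModuleFrobeniusProofs` for the full reciprocity `Hom_G(π, i_G(χ)) ≃ Hom_T(r_B π, χ)` of `U(3)(L⁺_v)`),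
  `rootDeltaChar … n = 1`, `rootDeltaChar … p = rootDeltaChar … (proj p)`, and J2 in `proj` form over ★ `Gqs L v` ∕
  ★ `cmXiTorusChar` (`exists_intertwiningMap_cmPrincipalSeries_xi_of_functional_proj`).
References: [Rogawski1990, §1.10, §12.1]; [BernsteinZelevinsky1977, 1.8, §2.3]; [BernsteinZelevinsky1976, Prop. 2.28].
-/

set_option autoImplicit false
set_option linter.dupNamespace false

noncomputable section

open NumberField IsDedekindDomain
open scoped MatrixGroups

namespace Summit.HodgeConjecture.HodgeConjecture.Cruxes.H413.F0P2nBorelCharactersUnipotent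

open Literature.NumberTheory.Automorphic Literature.NumberTheory.Automorphic.UnitaryGroup

/-! ## §1 `3 × 3` bookkeeping -/

section Generic

variable {R : Type*} [CommRing R]

/-- The antidiagonal form `Φ₃ = antidiag(1, 1, 1)` as an explicit `3 × 3` matrix. [cite: Rogawski1990, §1.9 p. 8] -/
theorem antidiagonal_three_over_eq : (StdForm.antidiagonal 3).over R = !![0, 0, 1; 0, 1, 0; 1, 0, 0] := by
  ext i j
  simp only [StdForm.over, Matrix.map_apply, StdForm.antidiagonal_J_apply]
  fin_cases i <;> fin_cases j <;> simp [Fin.ext_iff]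

/-- Entries of `Φ₃`. [cite: Rogawski1990, §1.9 p. 8] -/
theorem antidiagonal_three_over_apply (i j : Fin 3) :
    (StdForm.antidiagonal 3).over R i j = (!![0, 0, 1; 0, 1, 0; 1, 0, 0] : Matrix (Fin 3) (Fin 3) R) i j := by
  rw [antidiagonal_three_over_eq]

variable (σ : R →+* R)

/-- **Unitarity on `N` in Rogawski's coordinates**: an upper-unitriangular `u ∈ U(σ, Φ₃)(R)` has `u₁₂ = -σ(u₀₁)`
(`u = u(x, z)` with second super-diagonal entry `-x̄`). [cite: Rogawski1990, §1.10 p. 9] -/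
theorem apply_one_two_eq_of_mem_unipotentU {u : ↥(unitaryGroupOfForm σ ((StdForm.antidiagonal 3).over R))}
    (hu : u ∈ unipotentU σ ((StdForm.antidiagonal 3).over R)) :
    ((u : GL (Fin 3) R) : Matrix (Fin 3) (Fin 3) R) 1 2 = -σ (((u : GL (Fin 3) R) : Matrix (Fin 3) (Fin 3) R) 0 1) := by
  obtain ⟨hT, hD⟩ := (mem_unipotentU_iff u).1 hu
  have h21 : ((u : GL (Fin 3) R) : Matrix (Fin 3) (Fin 3) R) 2 1 = 0 := hT (by decide)
  have hmem := mem_unitaryGroupOfForm_iff.1 u.2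
  have h12 := congrFun (congrFun hmem 1) 2
  simp only [Matrix.mul_apply, Fin.sum_univ_three, Matrix.transpose_apply, Matrix.map_apply,
    antidiagonal_three_over_apply, Matrix.of_apply, Matrix.cons_val', Matrix.cons_val_zero, Matrix.cons_val_one,
    Matrix.cons_val_two, Matrix.empty_val', Matrix.cons_val_fin_one, Matrix.head_cons, Matrix.head_fin_const,
    Matrix.tail_cons, mul_zero, mul_one, zero_add, add_zero, hD 1, hD 2, h21, map_one, map_zero, zero_mul, one_mul] at h12
  linear_combination h12

/-- The diagonal element `d(α, 1, α⁻¹)` (`α ∈ Rˣ` with `σ α = α`) lies in `U(σ, Φ₃)(R)`. [cite: Rogawski1990, §1.10 p. 9] -/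
theorem glDiagonal_mem_unitaryGroupOfForm (α : Rˣ) (hα : σ α = α) :
    glDiagonal 3 R ![α, 1, α⁻¹] ∈ unitaryGroupOfForm σ ((StdForm.antidiagonal 3).over R) := by
  have hα' : σ ((α⁻¹ : Rˣ) : R) = ((α⁻¹ : Rˣ) : R) := by
    have h1 : (α : R) * σ ((α⁻¹ : Rˣ) : R) = 1 := by rw [← hα, ← map_mul, Units.mul_inv, map_one]
    calc σ ((α⁻¹ : Rˣ) : R) = ((α⁻¹ : Rˣ) : R) * ((α : R) * σ ((α⁻¹ : Rˣ) : R)) := by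
          rw [← mul_assoc, Units.inv_mul, one_mul]
      _ = ((α⁻¹ : Rˣ) : R) := by rw [h1, mul_one]
  rw [mem_unitaryGroupOfForm_iff, antidiagonal_three_over_eq, coe_glDiagonal]
  ext i j
  fin_cases i <;> fin_cases j <;>
    simp [Matrix.mul_apply, Fin.sum_univ_three, Matrix.diagonal, Matrix.map_apply, Matrix.transpose_apply, hα, hα']

/-- Conjugation by a diagonal matrix multiplies the `(i, j)` entry by `dᵢ dⱼ⁻¹`. [folklore] -/
theorem coe_glDiagonal_mul_mul_inv_apply (d : Fin 3 → Rˣ) (g : GL (Fin 3) R) (i j : Fin 3) :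
    ((glDiagonal 3 R d * g * (glDiagonal 3 R d)⁻¹ : GL (Fin 3) R) : Matrix (Fin 3) (Fin 3) R) i j =
      (d i : R) * (g : Matrix (Fin 3) (Fin 3) R) i j * ((d j)⁻¹ : Rˣ) := by
  rw [← map_inv, Units.val_mul, Units.val_mul, coe_glDiagonal, coe_glDiagonal, Matrix.mul_diagonal,
    Matrix.diagonal_mul, Pi.inv_apply]

end Generic

/-! ## §2 Every character of `B ≤ U(σ, Φ₃)(R)` is trivial on `N` -/

section Characters

variable {R : Type*} [CommRing R] (σ : R →+* R)

/-- An element of `N` with vanishing `(0,1)` entry is `u(0, z) = [[1,0,z],[0,1,0],[0,0,1]]` (its `(1,2)` entry `-σ(0)`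
vanishes by unitarity). [cite: Rogawski1990, §1.10 p. 9] -/
theorem coe_eq_of_mem_unipotentU_of_apply_zero_one
    {ζ : ↥(unitaryGroupOfForm σ ((StdForm.antidiagonal 3).over R))} (hζ : ζ ∈ unipotentU σ ((StdForm.antidiagonal 3).over R))
    (h01 : ((ζ : GL (Fin 3) R) : Matrix (Fin 3) (Fin 3) R) 0 1 = 0) :
    ((ζ : GL (Fin 3) R) : Matrix (Fin 3) (Fin 3) R) =
      !![1, 0, ((ζ : GL (Fin 3) R) : Matrix (Fin 3) (Fin 3) R) 0 2; 0, 1, 0; 0, 0, 1] := by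
  obtain ⟨hT, hD⟩ := (mem_unipotentU_iff ζ).1 hζ
  have h12 : ((ζ : GL (Fin 3) R) : Matrix (Fin 3) (Fin 3) R) 1 2 = 0 := by
    rw [apply_one_two_eq_of_mem_unipotentU σ hζ, h01, map_zero, neg_zero]
  have h10 : ((ζ : GL (Fin 3) R) : Matrix (Fin 3) (Fin 3) R) 1 0 = 0 := hT (by decide)
  have h20 : ((ζ : GL (Fin 3) R) : Matrix (Fin 3) (Fin 3) R) 2 0 = 0 := hT (by decide)
  have h21 : ((ζ : GL (Fin 3) R) : Matrix (Fin 3) (Fin 3) R) 2 1 = 0 := hT (by decide)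
  ext i j
  fin_cases i <;> fin_cases j <;> simp [hD 0, hD 1, hD 2, h01, h12, h10, h20, h21]

/-- Powers of `u(0, z)`: `u(0, z)ⁿ = u(0, n z)`. [cite: Rogawski1990, §1.10 p. 9] -/
theorem central_pow (z : R) (n : ℕ) :
    (!![1, 0, z; 0, 1, 0; 0, 0, 1] : Matrix (Fin 3) (Fin 3) R) ^ n = !![1, 0, (n : R) * z; 0, 1, 0; 0, 0, 1] := by
  induction n with
  | zero => rw [pow_zero, Nat.cast_zero, zero_mul, Matrix.one_fin_three]
  | succ n ih =>
    rw [pow_succ, ih, Matrix.mul_fin_three]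
    simp only [mul_one, mul_zero, zero_mul, add_zero, zero_add, one_mul, Nat.cast_succ, add_mul, add_comm z]

/-- **Every character of `B` kills `N`** (`2, 3 ∈ Rˣ`): for `χ : B →* C`, `C` a commutative group, and `u ∈ N ≤ B`,
`χ u = 1`. [cite: Rogawski1990, §1.10 p. 9] [cite: BernsteinZelevinsky1977, 1.8] -/
theorem map_eq_one_of_mem_unipotentU (h2 : IsUnit (2 : R)) (h3 : IsUnit (3 : R)) {C : Type*} [CommGroup C]
    (χ : ↥(borelU σ ((StdForm.antidiagonal 3).over R)) →* C)
    {u : ↥(unitaryGroupOfForm σ ((StdForm.antidiagonal 3).over R))} (hu : u ∈ unipotentU σ ((StdForm.antidiagonal 3).over R)) :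
    χ ⟨u, unipotentU_le_borelU σ _ hu⟩ = 1 := by
  -- the torus elements `t_α = d(α, 1, α⁻¹)` for `α = 2, 3`
  have hσ2 : σ ((h2.unit : Rˣ) : R) = (h2.unit : Rˣ) := by rw [IsUnit.unit_spec, map_ofNat]
  have hσ3 : σ ((h3.unit : Rˣ) : R) = (h3.unit : Rˣ) := by rw [IsUnit.unit_spec, map_ofNat]
  -- generic facts about `t_α`
  have tmemB : ∀ (α : Rˣ) (hα : σ α = α),
      (⟨glDiagonal 3 R ![α, 1, α⁻¹], glDiagonal_mem_unitaryGroupOfForm σ α hα⟩ :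
        ↥(unitaryGroupOfForm σ ((StdForm.antidiagonal 3).over R))) ∈ borelU σ ((StdForm.antidiagonal 3).over R) := by
    intro α hα
    rw [mem_borelU_iff]
    change (((glDiagonal 3 R ![α, 1, α⁻¹]) : GL (Fin 3) R) : Matrix (Fin 3) (Fin 3) R).BlockTriangular id
    rw [coe_glDiagonal]
    exact Matrix.blockTriangular_diagonal _
  -- Step A: for `ζ ∈ N` with `ζ₀₁ = 0`, `t_α ζ t_α⁻¹ = ζ ^ n` whenever `(n : R) = α²`; hence `χ ζ ^ n = χ ζ`.
  have stepA : ∀ (α : Rˣ) (hα : σ α = α) (n : ℕ) (hn : (n : R) = α * α)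
      (ζ : ↥(unitaryGroupOfForm σ ((StdForm.antidiagonal 3).over R)))
      (hζ : ζ ∈ unipotentU σ ((StdForm.antidiagonal 3).over R))
      (h01 : ((ζ : GL (Fin 3) R) : Matrix (Fin 3) (Fin 3) R) 0 1 = 0),
      χ ⟨ζ, unipotentU_le_borelU σ _ hζ⟩ ^ n = χ ⟨ζ, unipotentU_le_borelU σ _ hζ⟩ := by
    intro α hα n hn ζ hζ h01
    set t : ↥(unitaryGroupOfForm σ ((StdForm.antidiagonal 3).over R)) :=
      ⟨glDiagonal 3 R ![α, 1, α⁻¹], glDiagonal_mem_unitaryGroupOfForm σ α hα⟩ with htdef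
    have htB : t ∈ borelU σ ((StdForm.antidiagonal 3).over R) := tmemB α hα
    -- the conjugation identity in `U`
    have hconj : t * ζ * t⁻¹ = ζ ^ n := by
      apply Subtype.ext
      apply Units.ext
      rw [Subgroup.coe_mul, Subgroup.coe_mul, Subgroup.coe_inv, Subgroup.coe_pow, Units.val_pow_eq_pow_val,
        coe_eq_of_mem_unipotentU_of_apply_zero_one σ hζ h01, central_pow]
      ext i j
      rw [htdef, coe_glDiagonal_mul_mul_inv_apply, coe_eq_of_mem_unipotentU_of_apply_zero_one σ hζ h01]
      fin_cases i <;> fin_cases j <;> simp [hn]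
      ring
    -- apply `χ` in `B`
    have hB : (⟨t, htB⟩ : ↥(borelU σ ((StdForm.antidiagonal 3).over R))) * ⟨ζ, unipotentU_le_borelU σ _ hζ⟩ * ⟨t, htB⟩⁻¹ =
        ⟨ζ, unipotentU_le_borelU σ _ hζ⟩ ^ n := Subtype.ext hconj
    have := congrArg χ hB
    rw [map_mul, map_mul, map_inv, mul_right_comm, mul_inv_cancel, one_mul, map_pow] at this
    exact this.symm
  -- Step B: `χ ζ = 1` for such `ζ` (`χ ζ ^ 4 = χ ζ = χ ζ ^ 9`).
  have stepB : ∀ (ζ : ↥(unitaryGroupOfForm σ ((StdForm.antidiagonal 3).over R)))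
      (hζ : ζ ∈ unipotentU σ ((StdForm.antidiagonal 3).over R))
      (h01 : ((ζ : GL (Fin 3) R) : Matrix (Fin 3) (Fin 3) R) 0 1 = 0), χ ⟨ζ, unipotentU_le_borelU σ _ hζ⟩ = 1 := by
    intro ζ hζ h01
    set x := χ ⟨ζ, unipotentU_le_borelU σ _ hζ⟩ with hx
    have h4 : x ^ 4 = x := stepA h2.unit hσ2 4 (by rw [IsUnit.unit_spec]; norm_num) ζ hζ h01
    have h9 : x ^ 9 = x := stepA h3.unit hσ3 9 (by rw [IsUnit.unit_spec]; norm_num) ζ hζ h01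
    have h3' : x ^ 3 = 1 := mul_right_cancel (a := x ^ 3) (b := x) (c := 1) (by rw [← pow_succ, h4, one_mul])
    have h8 : x ^ 8 = 1 := mul_right_cancel (a := x ^ 8) (b := x) (c := 1) (by rw [← pow_succ, h9, one_mul])
    calc x = x ^ 8 * x := by rw [h8, one_mul]
      _ = x ^ 9 := (pow_succ x 8).symm
      _ = (x ^ 3) ^ 3 := by rw [← pow_mul]
      _ = 1 := by rw [h3', one_pow]
  -- Step C: `t_2 u t_2⁻¹ = u² ζ` with `ζ ∈ N`, `ζ₀₁ = 0`.
  obtain ⟨t, htval, htB⟩ : ∃ t : ↥(unitaryGroupOfForm σ ((StdForm.antidiagonal 3).over R)),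
      (t : GL (Fin 3) R) = glDiagonal 3 R ![h2.unit, 1, h2.unit⁻¹] ∧ t ∈ borelU σ ((StdForm.antidiagonal 3).over R) :=
    ⟨⟨_, glDiagonal_mem_unitaryGroupOfForm σ h2.unit hσ2⟩, rfl, tmemB h2.unit hσ2⟩
  set ζ : ↥(unitaryGroupOfForm σ ((StdForm.antidiagonal 3).over R)) := (u * u)⁻¹ * (t * u * t⁻¹) with hζdef
  have hconjN : t * u * t⁻¹ ∈ unipotentU σ ((StdForm.antidiagonal 3).over R) :=
    (Subgroup.mem_normalizer_iff.1 (borelU_le_normalizer σ _ htB) u).1 hu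
  have hζN : ζ ∈ unipotentU σ ((StdForm.antidiagonal 3).over R) :=
    mul_mem (inv_mem (mul_mem hu hu)) hconjN
  have hprod : u * u * ζ = t * u * t⁻¹ := by rw [hζdef, mul_inv_cancel_left]
  -- entries
  obtain ⟨huT, huD⟩ := (mem_unipotentU_iff u).1 hu
  obtain ⟨hζT, hζD⟩ := (mem_unipotentU_iff ζ).1 hζN
  have hu10 : ((u : GL (Fin 3) R) : Matrix (Fin 3) (Fin 3) R) 1 0 = 0 := huT (by decide)
  have hu20 : ((u : GL (Fin 3) R) : Matrix (Fin 3) (Fin 3) R) 2 0 = 0 := huT (by decide)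
  have hu21 : ((u : GL (Fin 3) R) : Matrix (Fin 3) (Fin 3) R) 2 1 = 0 := huT (by decide)
  have hζ10 : ((ζ : GL (Fin 3) R) : Matrix (Fin 3) (Fin 3) R) 1 0 = 0 := hζT (by decide)
  have hζ20 : ((ζ : GL (Fin 3) R) : Matrix (Fin 3) (Fin 3) R) 2 0 = 0 := hζT (by decide)
  have hζ21 : ((ζ : GL (Fin 3) R) : Matrix (Fin 3) (Fin 3) R) 2 1 = 0 := hζT (by decide)
  have h01 : ((ζ : GL (Fin 3) R) : Matrix (Fin 3) (Fin 3) R) 0 1 = 0 := by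
    -- entry `(0,1)` of `u u ζ = t u t⁻¹`: `ζ₀₁ + 2 u₀₁ = 2 u₀₁`
    have h : (((u * u * ζ : ↥(unitaryGroupOfForm σ ((StdForm.antidiagonal 3).over R))) : GL (Fin 3) R) :
        Matrix (Fin 3) (Fin 3) R) 0 1 =
        (((t * u * t⁻¹ : ↥(unitaryGroupOfForm σ ((StdForm.antidiagonal 3).over R))) : GL (Fin 3) R) :
          Matrix (Fin 3) (Fin 3) R) 0 1 := by
      rw [hprod]
    have hL : (((u * u * ζ : ↥(unitaryGroupOfForm σ ((StdForm.antidiagonal 3).over R))) : GL (Fin 3) R) :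
        Matrix (Fin 3) (Fin 3) R) = ((u : GL (Fin 3) R) : Matrix (Fin 3) (Fin 3) R) * ((u : GL (Fin 3) R) : Matrix (Fin 3) (Fin 3) R) *
          ((ζ : GL (Fin 3) R) : Matrix (Fin 3) (Fin 3) R) := rfl
    have hR : ((t * u * t⁻¹ : ↥(unitaryGroupOfForm σ ((StdForm.antidiagonal 3).over R))) : GL (Fin 3) R) =
        glDiagonal 3 R ![h2.unit, 1, h2.unit⁻¹] * (u : GL (Fin 3) R) * (glDiagonal 3 R ![h2.unit, 1, h2.unit⁻¹])⁻¹ := by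
      rw [← htval]; rfl
    rw [hL, hR, coe_glDiagonal_mul_mul_inv_apply] at h
    simp only [Matrix.mul_apply, Fin.sum_univ_three, huD 0, huD 1, hu10, hu20, hu21, hζD 1, hζ21,
      mul_one, one_mul, mul_zero, add_zero, Matrix.cons_val_zero, Matrix.cons_val_one,
      inv_one, Units.val_one, IsUnit.unit_spec] at h
    linear_combination h
  have hζ1 : χ ⟨ζ, unipotentU_le_borelU σ _ hζN⟩ = 1 := stepB ζ hζN h01
  -- Step D: apply `χ` to `u u ζ = t u t⁻¹` in `B`
  have hB : (⟨u, unipotentU_le_borelU σ _ hu⟩ : ↥(borelU σ ((StdForm.antidiagonal 3).over R))) * ⟨u, unipotentU_le_borelU σ _ hu⟩ *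
      ⟨ζ, unipotentU_le_borelU σ _ hζN⟩ = ⟨t, htB⟩ * ⟨u, unipotentU_le_borelU σ _ hu⟩ * ⟨t, htB⟩⁻¹ := Subtype.ext hprod
  have h := congrArg χ hB
  rw [map_mul, map_mul, hζ1, mul_one, map_mul, map_mul, map_inv, mul_right_comm, mul_inv_cancel, one_mul] at h
  exact mul_left_cancel (a := χ ⟨u, unipotentU_le_borelU σ _ hu⟩) (by rw [h, mul_one])

/-- The same for a form `J` GIVEN as `Φ₃` by an equation (the shape of ★ `borelTriple σ J hJ` ∕ ★ `cmBorelTriple`).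
[cite: Rogawski1990, §1.10 p. 9] [cite: BernsteinZelevinsky1977, 1.8] -/
theorem map_eq_one_of_mem_unipotentU_of_eq {J : Matrix (Fin 3) (Fin 3) R} (hJ : J = (StdForm.antidiagonal 3).over R)
    (h2 : IsUnit (2 : R)) (h3 : IsUnit (3 : R)) {C : Type*} [CommGroup C] (χ : ↥(borelU σ J) →* C)
    {u : ↥(unitaryGroupOfForm σ J)} (hu : u ∈ unipotentU σ J) : χ ⟨u, unipotentU_le_borelU σ J hu⟩ = 1 := by
  subst hJ
  exact map_eq_one_of_mem_unipotentU σ h2 h3 χ hu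

/-- **Characters of `B` factor through the Levi projection**: `χ p = χ (proj p)` for every `p ∈ B = T N` (`p = proj p · n`,
`n ∈ N`, and `χ` kills `N`). [cite: Rogawski1990, §1.10 p. 9] [cite: BernsteinZelevinsky1977, 1.8] -/
theorem map_eq_map_proj_of_eq {J : Matrix (Fin 3) (Fin 3) R} (hJ : J = (StdForm.antidiagonal 3).over R)
    (h2 : IsUnit (2 : R)) (h3 : IsUnit (3 : R)) {C : Type*} [CommGroup C] (χ : ↥(borelTriple σ J hJ).P →* C)
    (p : ↥(borelTriple σ J hJ).P) :
    χ p = χ ⟨((borelTriple σ J hJ).proj p : ↥(unitaryGroupOfForm σ J)), (borelTriple σ J hJ).M_le ((borelTriple σ J hJ).proj p).2⟩ := by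
  set m : ↥(borelTriple σ J hJ).P :=
    ⟨((borelTriple σ J hJ).proj p : ↥(unitaryGroupOfForm σ J)), (borelTriple σ J hJ).M_le ((borelTriple σ J hJ).proj p).2⟩ with hm
  have hn : ((m⁻¹ * p : ↥(borelTriple σ J hJ).P) : ↥(unitaryGroupOfForm σ J)) ∈ unipotentU σ J :=
    (borelTriple σ J hJ).proj_inv_mul_mem p
  have hkill : χ (m⁻¹ * p) = 1 := by
    have h := map_eq_one_of_mem_unipotentU_of_eq σ hJ h2 h3 χ hn
    convert h using 2
  calc χ p = χ (m * (m⁻¹ * p)) := by rw [mul_inv_cancel_left]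
    _ = χ m := by rw [map_mul, hkill, mul_one]

end Characters

/-! ## §3 The modulus of a parabolic is determined by the Levi part when it is trivial on `N` -/

section Modulus

variable {G : Type*} [Group G] [TopologicalSpace G] [IsTopologicalGroup G] (t : ParabolicTriple G) [LocallyCompactSpace t.P]

/-- If `δ_P^{1/2}` is trivial on `N` then `δ_P^{1/2}(p) = δ_P^{1/2}(proj p)` (`p = proj p · n`). [cite: BernsteinZelevinsky1977, 1.8] -/
theorem rootDeltaChar_eq_rootDeltaChar_proj
    (hδ : ∀ (n : G) (hn : n ∈ t.N), rootDeltaChar t.P ⟨n, t.N_le hn⟩ = 1) (p : t.P) :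
    rootDeltaChar t.P p = rootDeltaChar t.P ⟨(t.proj p : G), t.M_le (t.proj p).2⟩ := by
  set m : t.P := ⟨(t.proj p : G), t.M_le (t.proj p).2⟩ with hm
  have hn : ((m⁻¹ * p : t.P) : G) ∈ t.N := t.proj_inv_mul_mem p
  have hkill : rootDeltaChar t.P (m⁻¹ * p) = 1 := by
    have h := hδ _ hn
    convert h using 2
  calc rootDeltaChar t.P p = rootDeltaChar t.P (m * (m⁻¹ * p)) := by rw [mul_inv_cancel_left]
    _ = rootDeltaChar t.P m := by rw [map_mul, hkill, mul_one]

/-- `δ_P = (δ_P^{1/2})²` is trivial on `N` when its square root is. [folklore] -/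
theorem deltaChar_eq_one_of_rootDeltaChar (hδ : ∀ (n : G) (hn : n ∈ t.N), rootDeltaChar t.P ⟨n, t.N_le hn⟩ = 1)
    (n : G) (hn : n ∈ t.N) : deltaChar t.P ⟨n, t.N_le hn⟩ = 1 := by
  rw [← rootDeltaChar_sq, hδ n hn, one_pow]

variable {W V : Type*} [AddCommGroup V] [Module ℂ V]

/-- **J2 with the modulus read on the Levi part.**  If `δ_P^{1/2}|_N = 1`, a smooth `π` with a functional `ℓ`, `ℓ v₀ ≠ 0`,
equivariant for `p ↦ χ (proj p) · δ_P^{1/2} (proj p)` on `P`, has a `G`-map `Φ : π → i_P^G χ` with `Φ v₀ ≠ 0`,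
`(Φ v) g = ℓ (π g v)` (★ `Representation.frobeniusInv`). [cite: BernsteinZelevinsky1976, Proposition 2.28] [cite: BernsteinZelevinsky1977, §2.3] -/
theorem exists_intertwiningMap_normalizedInd_character_of_functional_proj
    (hδ : ∀ (n : G) (hn : n ∈ t.N), rootDeltaChar t.P ⟨n, t.N_le hn⟩ = 1) (χ : t.M →* ℂˣ) (π : Representation ℂ G V)
    (hπ : π.IsSmooth) (ℓ : V →ₗ[ℂ] ℂ)
    (hℓ : ∀ (p : t.P) (v : V), ℓ (π p v) =
      ((χ (t.proj p) : ℂˣ) : ℂ) * ((rootDeltaChar t.P ⟨(t.proj p : G), t.M_le (t.proj p).2⟩ : ℂˣ) : ℂ) * ℓ v)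
    (v₀ : V) (hv₀ : ℓ v₀ ≠ 0) :
    ∃ Φ : π.IntertwiningMap (Representation.normalizedInd t ((Representation.trivial ℂ t.M ℂ).twist χ)),
      Φ v₀ ≠ 0 ∧ ∀ (v : V) (g : G), (Φ v).toFun g = ℓ (π g v) := by
  have hℓ' : ∀ (p : t.P) (v : V), ℓ ((π.comp t.P.subtype) p v) =
      Representation.twist (((Representation.trivial ℂ t.M ℂ).twist χ).comp t.proj) (rootDeltaChar t.P) p (ℓ v) := by
    intro p v
    rw [F0P2nFrobeniusFunctional.twist_comp_proj_character_apply, rootDeltaChar_eq_rootDeltaChar_proj t hδ p]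
    exact hℓ p v
  refine ⟨Representation.frobeniusInv hπ (ℓ.intertwiningMap_of_isIntertwiningMap _ _ hℓ'), fun h => hv₀ ?_,
    fun v g => Representation.toFun_frobeniusInv_apply hπ _ v g⟩
  have h1 := congrArg (fun F : Representation.SmoothInd t.P _ => F.toFun 1) h
  change ℓ (π 1 v₀) = _ at h1
  rw [map_one, Module.End.one_apply] at h1
  exact h1

end Modulus

/-! ## §4 The CM Borel `B(L⁺_v) ≤ U(Φ₃)(L⁺_v)`: `δ_B|_N = 1`, Frobenius reciprocity for `i_G(χ)`, and J2 in `proj` form -/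

section CM

variable (L : Type) [Field L] [NumberField L] [IsCMField L]

omit [IsCMField L] in
/-- `3` is a unit of `∏_{w ∣ v} L_w` (a product of fields of characteristic `0`; `2` is ★ `Rogawski1990.isUnit_two_localRing`,
re-derived inline below to keep this file's import cone small). [folklore] -/
theorem isUnit_three_localRing (v : HeightOneSpectrum (𝓞 ↥(maximalRealSubfield L))) : IsUnit (3 : LocalRing L v) := by
  refine isUnit_iff_exists_inv.2 ⟨fun w => (3 : w.1.adicCompletion L)⁻¹, funext fun _ => ?_⟩
  exact mul_inv_cancel₀ three_ne_zero

/-- **Every character of the Borel `B(L⁺_v)` of `U(3)(L⁺_v)` kills `N(L⁺_v)`.** [cite: Rogawski1990, §1.10 p. 9]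
[cite: BernsteinZelevinsky1977, 1.8] -/
theorem map_eq_one_of_mem_cmUnipotentU (v : HeightOneSpectrum (𝓞 ↥(maximalRealSubfield L))) {C : Type*} [CommGroup C]
    (χ : ↥(cmBorelTriple L 3 v).P →* C)
    {u : ↥(unitaryGroupOfForm (conjLocal L (IsCMField.complexConj L) v) (cmLocalForm L 3 v))}
    (hu : u ∈ unipotentU (conjLocal L (IsCMField.complexConj L) v) (cmLocalForm L 3 v)) :
    χ ⟨u, unipotentU_le_borelU _ _ hu⟩ = 1 :=
  map_eq_one_of_mem_unipotentU_of_eq (conjLocal L (IsCMField.complexConj L) v) (cmLocalForm_eq_over L 3 v)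
    (isUnit_iff_exists_inv.2 ⟨fun w => (2 : w.1.adicCompletion L)⁻¹, funext fun _ => mul_inv_cancel₀ two_ne_zero⟩)
    (isUnit_three_localRing L v) χ hu

/-- **`δ_B^{1/2}` is trivial on `N(L⁺_v)`** — the hypothesis of Bernstein–Zelevinsky's Frobenius reciprocity for NORMALISED
induction (★ `Representation.frobenius_normalizedInd`), for the Borel of `U(3)(L⁺_v)`. [cite: BernsteinZelevinsky1977, 1.8, §2.3] -/
theorem rootDeltaChar_cmBorel_eq_one (v : HeightOneSpectrum (𝓞 ↥(maximalRealSubfield L)))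
    (n : ↥(unitaryGroupOfForm (conjLocal L (IsCMField.complexConj L) v) (cmLocalForm L 3 v))) (hn : n ∈ (cmBorelTriple L 3 v).N) :
    haveI := locallyCompactSpace_cmBorelU L 3 v
    rootDeltaChar (cmBorelTriple L 3 v).P ⟨n, (cmBorelTriple L 3 v).N_le hn⟩ = 1 :=
  haveI := locallyCompactSpace_cmBorelU L 3 v
  map_eq_one_of_mem_cmUnipotentU L v (rootDeltaChar (cmBorelTriple L 3 v).P) hn

/-- **`δ_B` is trivial on `N(L⁺_v)`** (the `hδ` of ★ `Representation.frobenius_normalizedInd`, verbatim shape).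
[cite: BernsteinZelevinsky1977, 1.8] -/
theorem deltaChar_cmBorel_eq_one (v : HeightOneSpectrum (𝓞 ↥(maximalRealSubfield L)))
    (n : ↥(unitaryGroupOfForm (conjLocal L (IsCMField.complexConj L) v) (cmLocalForm L 3 v))) (hn : n ∈ (cmBorelTriple L 3 v).N) :
    haveI := locallyCompactSpace_cmBorelU L 3 v
    deltaChar (cmBorelTriple L 3 v).P ⟨n, (cmBorelTriple L 3 v).N_le hn⟩ = 1 :=
  haveI := locallyCompactSpace_cmBorelU L 3 v
  map_eq_one_of_mem_cmUnipotentU L v (deltaChar (cmBorelTriple L 3 v).P) hn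

/-- `δ_B^{1/2}(p) = δ_B^{1/2}(proj p)` on `B(L⁺_v)`. [cite: BernsteinZelevinsky1977, 1.8] -/
theorem rootDeltaChar_cmBorel_eq_proj (v : HeightOneSpectrum (𝓞 ↥(maximalRealSubfield L))) (p : ↥(cmBorelTriple L 3 v).P) :
    haveI := locallyCompactSpace_cmBorelU L 3 v
    rootDeltaChar (cmBorelTriple L 3 v).P p =
      rootDeltaChar (cmBorelTriple L 3 v).P ⟨((cmBorelTriple L 3 v).proj p : ↥(unitaryGroupOfForm _ _)),
        (cmBorelTriple L 3 v).M_le ((cmBorelTriple L 3 v).proj p).2⟩ :=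
  haveI := locallyCompactSpace_cmBorelU L 3 v
  rootDeltaChar_eq_rootDeltaChar_proj (cmBorelTriple L 3 v) (rootDeltaChar_cmBorel_eq_one L v) p

/-- **J2 in `proj` form, letter tokens.**  A smooth `π` of `U(3)(L⁺_v)` = ★ `Rogawski1990.Gqs L v` with a functional `ℓ`,
`ℓ w₀ ≠ 0`, equivariant for the character `p ↦ χ_ξ (proj p) · δ_B^{1/2} (proj p)` of `B(L⁺_v)` (the shape a Jacquet-module ∕
`N`-coinvariant functional delivers; `χ_ξ` = ★ `cmXiTorusChar L v μ η₁ η₂`) has a `G`-map `Φ : π → i_G(χ_ξ)` with `Φ w₀ ≠ 0` and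
`(Φ w) g = ℓ (π g w)`. [cite: BernsteinZelevinsky1976, Proposition 2.28] [cite: Rogawski1990, §12.2 p. 174] -/
theorem exists_intertwiningMap_cmPrincipalSeries_xi_of_functional_proj (v : HeightOneSpectrum (𝓞 ↥(maximalRealSubfield L)))
    (μ : (LocalRing L v)ˣ →* ℂˣ) (η₁ η₂ : ↥(normOneUnits (conjLocal L (IsCMField.complexConj L) v)) →* ℂˣ)
    {V : Type*} [AddCommGroup V] [Module ℂ V] (π : Representation ℂ (Literature.NumberTheory.Rogawski1990.Gqs L v) V)
    (hπ : π.IsSmooth) (ℓ : V →ₗ[ℂ] ℂ)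
    (hℓ : haveI := locallyCompactSpace_cmBorelU L 3 v
      ∀ (p : ↥(cmBorelTriple L 3 v).P) (w : V),
        ℓ (π p.1 w) = ((cmXiTorusChar L v μ η₁ η₂ ((cmBorelTriple L 3 v).proj p) : ℂˣ) : ℂ) *
          ((rootDeltaChar (cmBorelTriple L 3 v).P ⟨((cmBorelTriple L 3 v).proj p : ↥(unitaryGroupOfForm _ _)),
            (cmBorelTriple L 3 v).M_le ((cmBorelTriple L 3 v).proj p).2⟩ : ℂˣ) : ℂ) * ℓ w)
    (w₀ : V) (hw₀ : ℓ w₀ ≠ 0) :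
    ∃ Φ : π.IntertwiningMap (cmPrincipalSeries L 3 v (cmXiTorusChar L v μ η₁ η₂)),
      Φ w₀ ≠ 0 ∧ ∀ (w : V) (g : _), (Φ w).toFun g = ℓ (π g w) :=
  haveI := locallyCompactSpace_cmBorelU L 3 v
  exists_intertwiningMap_normalizedInd_character_of_functional_proj (cmBorelTriple L 3 v) (rootDeltaChar_cmBorel_eq_one L v)
    (cmXiTorusChar L v μ η₁ η₂) π hπ ℓ hℓ w₀ hw₀

end CM

end Summit.HodgeConjecture.HodgeConjecture.Cruxes.H413.F0P2nBorelCharactersUnipotent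

end
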